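import Summits.Schanuel.Schanuel.Theorems.RootDecomp1ELevelTransport01

/-!
# RootDecomp1ELevelTransport — lens 2, generation 43 «POWER TRANSPORT — norm the transcendental LEVEL, not only the radix» (lanes E-R20 (β) + E-R19 (ii) + (α′); VERDICT L2157: THEOREM ×1 «hX-ELIMINATION on the tree class InRadixClass by level transport» + ONE CELL on the `√2·log 2`-weighted radix class `InQuadRadixClass` with E-STABLE members `zGS`, mod the ONE new print-faithful named fact `Waldschmidt1978_thm_4_7` (Literature)): the second resultant `powerNorm 𝔐 R₀ = Res_X(R₀(X), X^𝔐 − Y)` = the norm N_{ℚ(κ)(x)/ℚ(κ)} written in κ, transcendence TYPE as the only diophantine input, the λ-weighted radix curve, the level-transport engine, T1 binder-free radix line, T3 cells serving item 31409 — continuation (RootDecomp1ELevelTransport02): §3 λ-weighted radix curve + §4 engine helpers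

(lens-2 g43 HOME kernel LevelTransport.lean — graded copy 6f4fbb98… 1285 l; ported copy 746096cb… = graded + the critic's PORT CONDITION K:1117 `z ↦ w` in the carried IH binder of `cell_31410 (h47)` (one token, applied by the lens 17:36Z); imports tree RootDecomp1ERadixCell07 + Literature ExpOneTranscendenceMeasureProofs + Mathlib KummerExtension; CLAIM L2118, ACK/CHECKLIST E-g43 L2127, NODE L2152 / REQUEST L2153, writer re-check L2156, critic VERDICT L2157 (CLEARED as priced: THEOREM ×1 (T1) + ONE CELL (T3); lens-2 tally CELL ×5 + THEOREM ×1; RULE E-R21 L2158; PORT GO 01–0k `--supports stmt-Schanuel-31409`); port by census-1 gen 18 as `RootDecomp1ELevelTransport01`–`04`: 01 = §1 the power norm `powerNorm` / `norm_aeval_powerNorm` / `map_powerNorm_eq` / `natDegree_powerNorm` / `powerNorm_ne_zero` + §2 `TranscendenceType` (DEFINITION), `transcendenceType_exp_mul_log (h47)` (α^β has type 5); 02 = §3 the λ-weighted radix curve `radixPtL` + §4 engine helpers; 03 = §4 THE LEVEL-TRANSPORT ENGINE `algebraicIndependent_radixPtL_of_type` (scoped `maxHeartbeats 800000` as in K);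 04 = §5 T1 binder-free (`algebraicIndependent_radixPt_free`, `schanuel_inRadixClass_free`, `cell_25020_free` / `cell_31410_free`, `schanuel_zMix_towerNumber_free`), T3 `InQuadRadixClass` (DEFINITION), `transcendenceType_two_pow_sqrt_two (h47)`, `schanuel_inQuadRadixClass (h47)`, `cell_31409 (h47)` / `cell_25020 (h47)` / `cell_31410 (h47)`, members `zGS`, `eStable_zGS`, `schanuel_zGS_towerNumber (h47)`, separation, the dichotomy `not_transcendenceType_of_isAlgebraic` / `not_transcendenceType_two`.
PORT EDITS: the named fact `def Waldschmidt1978_thm_4_7` MOVED to the NEW Literature statement file Literature/NumberTheory/Transcendental/AlphaBetaTranscendenceMeasure.lean (census proposal, [cite: Waldschmidt1978, Thm 4.7]) and referenced through `open Literature.NumberTheory.Transcendental (Waldschmidt1978_thm_4_7)`; K's six private helpers as per-part private copies; statements and proofs otherwise verbatim (0 undocumented decls in K). `--supports stmt-Schanuel-31409`; no census credit carried; rung 0 — nothing here proves Schanuel; items 31409/25020/31410 stay OPEN.)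
-/

noncomputable section

open Complex Polynomial IntermediateField Filter
open scoped BigOperators Topology

namespace Summit.Schanuel.Schanuel.Theorems.RootDecomp1ELevelTransport

open Summit.Schanuel.Schanuel.Theorems.RootDecomp1ERadixCell
open Summit.Schanuel.Schanuel.Theorems.RootDecomp1EUntwistedWall (gι gaussPt expo coef tail fib IsZ wden wden_pos
  isZ_expo Wb Wb_nonneg abs_expo_le abs_coef_le coef_cast fib_ne_zero expo_eq_of_tail_eq)
open Summit.Schanuel.Schanuel.Theorems.RootDecomp1KHyper
open Summit.Schanuel.Schanuel.Theorems.RootDecomp1KHyper.HyperCell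
open Summit.Schanuel.Schanuel.Theorems.RootDecomp1KGeneric (LiouvilleOrder)
open Summit.Schanuel.Schanuel.Theorems.RootDecomp1KFiniteOrderCell (towerNumber liouvilleOrder_towerNumber
  not_hyperLiouville_towerNumber towerNumber_pos not_liouvilleOrder_towerNumber)
open Summit.Schanuel.Schanuel.Theorems.RootDecomp1BDefectFloorCells (natCast_le_trdeg_of_algebraicIndependent)
open Summit.Schanuel.Schanuel.Theorems.RootDecomp1BRadicalDescent (exists_int_relation)
open Literature.NumberTheory.Transcendental (Waldschmidt1978_thm_4_7)

/-! ## §3  THE `λ`-WEIGHTED RADIX CURVE — weights `u·λ + v·log 2`; at the collapse the LEVEL is `x = e^{λ/𝔐}` -/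

section LevelPoint

variable {n : ℕ}

/-- The `λ`-weighted radix weight `ρ_λ(u, v) = u·λ + v·log 2` (real); g42's `ρr` is `λ = 1`. -/
def ρrL (lam : ℝ) (γ : ℚ × ℚ) : ℝ := (γ.1 : ℝ) * lam + (γ.2 : ℝ) * Real.log 2

/-- The `λ`-weighted radix weight read in `ℂ`. -/
def ριL (lam : ℝ) (γ : ℚ × ℚ) : ℂ := ((ρrL lam γ : ℝ) : ℂ)

/-- **The `λ`-radix-curve point** `(x, e^{ρ_λ(w_l) x^{e_l}})_l = (x, κ^{u_l x^{e_l}} · 2^{v_l x^{e_l}})_l`,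
`κ = e^λ`, for `w_l = (u_l, v_l)`. -/
def radixPtL (lam : ℝ) (w : Fin n → ℚ × ℚ) (e : Fin n → ℕ) (x : ℂ) : Fin (n + 1) → ℂ :=
  Fin.cons x fun l => cexp (ριL lam (w l) * x ^ (e l))

/-- The `0`-th coordinate of the `λ`-radix point is the parameter. -/
@[simp] theorem radixPtL_zero (lam : ℝ) (w : Fin n → ℚ × ℚ) (e : Fin n → ℕ) (x : ℂ) :
    radixPtL lam w e x 0 = x := by
  simp [radixPtL]

/-- The `l+1`-st coordinate of the `λ`-radix point. -/
@[simp] theorem radixPtL_succ (lam : ℝ) (w : Fin n → ℚ × ℚ) (e : Fin n → ℕ) (x : ℂ) (l : Fin n) :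
    radixPtL lam w e x l.succ = cexp (ριL lam (w l) * x ^ (e l)) := by
  simp [radixPtL]

/-- g42's radix weight is the `λ = 1` weight. -/
theorem ρr_eq_ρrL_one (γ : ℚ × ℚ) : ρr γ = ρrL 1 γ := by
  simp [ρr, ρrL]

/-- g42's radix point (tree `radixPt`) IS the `λ = 1` point. -/
theorem radixPt_eq_radixPtL_one (w : Fin n → ℚ × ℚ) (e : Fin n → ℕ) (x : ℂ) :
    radixPt w e x = radixPtL 1 w e x := by
  ext i
  refine Fin.cases ?_ (fun l => ?_) i
  · simp
  · simp [ρι, ριL, ρr_eq_ρrL_one]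

/-- `F_λ(x) = P(x, e^{ρ_λ(w_l) x^{e_l}})` along the reals, as an exponential sum over the support. -/
def FRL (lam : ℝ) (P : MvPolynomial (Fin (n + 1)) ℤ) (w : Fin n → ℚ × ℚ) (e : Fin n → ℕ) (x : ℝ) : ℂ :=
  ∑ s ∈ P.support, ((MvPolynomial.coeff s P : ℤ) : ℂ) * (x : ℂ) ^ (s 0) *
    cexp (∑ l : Fin n, (s l.succ : ℂ) * (ριL lam (w l) * (x : ℂ) ^ (e l)))

/-- The collapsed exponent read through the `λ`-weight: `ρ_λ(expo_s) = Σ_l s_{l+1} ρ_λ(w_l) r^{e_l}`. -/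
theorem ριL_expo (lam : ℝ) (w : Fin n → ℚ × ℚ) (e : Fin n → ℕ) (r : ℚ) (s : Fin (n + 1) →₀ ℕ) :
    ριL lam (expo w e r s) = ∑ l : Fin n, (s l.succ : ℂ) * (ριL lam (w l) * (r : ℂ) ^ (e l)) := by
  have h : ∀ l : Fin n, (s l.succ : ℂ) * (ριL lam (w l) * (r : ℂ) ^ (e l)) =
      ((s l.succ : ℂ) * ((w l).1 : ℂ) * (r : ℂ) ^ (e l)) * ((lam : ℝ) : ℂ) +
        ((s l.succ : ℂ) * ((w l).2 : ℂ) * (r : ℂ) ^ (e l)) * ((Real.log 2 : ℝ) : ℂ) := by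
    intro l; simp only [ριL, ρrL]; push_cast; ring
  rw [Finset.sum_congr rfl fun l _ => h l, Finset.sum_add_distrib, ← Finset.sum_mul, ← Finset.sum_mul]
  simp only [ριL, ρrL, expo]
  push_cast
  rfl

/-- `FRL lam P w e x` is the evaluation of `P` at the `λ`-radix point with parameter `x`. -/
theorem FRL_eq_aeval (lam : ℝ) (P : MvPolynomial (Fin (n + 1)) ℤ) (w : Fin n → ℚ × ℚ) (e : Fin n → ℕ)
    (x : ℝ) : FRL lam P w e x = MvPolynomial.aeval (radixPtL lam w e (x : ℂ)) P := by
  rw [MvPolynomial.aeval_def, MvPolynomial.eval₂_eq', FRL]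
  refine Finset.sum_congr rfl fun s _ => ?_
  rw [Fin.prod_univ_succ]
  simp only [algebraMap_int_eq, eq_intCast, radixPtL_zero, radixPtL_succ]
  have hprod : ∏ l : Fin n, cexp (ριL lam (w l) * (x : ℂ) ^ (e l)) ^ (s l.succ) =
      cexp (∑ l : Fin n, (s l.succ : ℂ) * (ριL lam (w l) * (x : ℂ) ^ (e l))) := by
    rw [Complex.exp_sum]
    exact Finset.prod_congr rfl fun l _ => by rw [← Complex.exp_nat_mul]
  rw [hprod]
  ring

/-- `FRL lam P w e` is `C¹` along the reals. -/
theorem contDiff_FRL (lam : ℝ) (P : MvPolynomial (Fin (n + 1)) ℤ) (w : Fin n → ℚ × ℚ) (e : Fin n → ℕ) :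
    ContDiff ℝ 1 (FRL lam P w e) := by
  unfold FRL
  have hx : ContDiff ℝ 1 (fun x : ℝ => (x : ℂ)) := Complex.ofRealCLM.contDiff
  refine ContDiff.sum fun s _ => ?_
  exact (contDiff_const.mul (hx.pow _)).mul
    (Complex.contDiff_exp.comp (ContDiff.sum fun l _ => contDiff_const.mul (contDiff_const.mul (hx.pow _))))

/-- Local Lipschitz bound for `FRL lam P w e` at `T`. -/
theorem exists_lipschitz_FRL (lam : ℝ) (P : MvPolynomial (Fin (n + 1)) ℤ) (w : Fin n → ℚ × ℚ)
    (e : Fin n → ℕ) (T : ℝ) : ∃ K δ₁ : ℝ, 0 ≤ K ∧ 0 < δ₁ ∧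
      ∀ x : ℝ, |x - T| < δ₁ → ‖FRL lam P w e x - FRL lam P w e T‖ ≤ K * |x - T| := by
  obtain ⟨K, t, ht, hK⟩ := ((contDiff_FRL lam P w e).contDiffAt (x := T)).exists_lipschitzOnWith
  obtain ⟨δ₁, hδ₁, hball⟩ := Metric.mem_nhds_iff.mp ht
  refine ⟨K, δ₁, K.2, hδ₁, fun x hx => ?_⟩
  have hxt : x ∈ t := hball (by rw [Metric.mem_ball, Real.dist_eq]; exact hx)
  have hTt : T ∈ t := hball (Metric.mem_ball_self hδ₁)
  have := (lipschitzOnWith_iff_dist_le_mul.mp hK) x hxt T hTt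
  rwa [dist_eq_norm, Real.dist_eq] at this

/-- **The collapse identity** `Σ_s coef_s · e^{ρ_λ(expo_s)} = den(r)^D · F_λ(r)`. -/
theorem sum_coef_expL (lam : ℝ) (P : MvPolynomial (Fin (n + 1)) ℤ) {D : ℕ} (hD : ∀ s ∈ P.support, s 0 ≤ D)
    (w : Fin n → ℚ × ℚ) (e : Fin n → ℕ) (r : ℚ) :
    ∑ s ∈ P.support, (coef P D r s : ℂ) * cexp (ριL lam (expo w e r s)) =
      (r.den : ℂ) ^ D * FRL lam P w e (r : ℝ) := by
  rw [FRL, Finset.mul_sum]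
  refine Finset.sum_congr rfl fun s hs => ?_
  rw [coef_cast P (hD s hs), ριL_expo]
  push_cast
  ring

/-- **THE LEVEL** at the collapse: `x_λ(𝔐) = e^{λ/𝔐}` — a `𝔐`-th root of the FIXED number `κ = e^λ`. -/
def xlev (lam : ℝ) (M : ℕ) : ℝ := Real.exp (lam * ((M : ℕ) : ℝ)⁻¹)

/-- The level is positive. -/
theorem xlev_pos (lam : ℝ) (M : ℕ) : 0 < xlev lam M := Real.exp_pos _

/-- `x_λ(𝔐)^𝔐 = e^λ`. -/
theorem xlev_pow (lam : ℝ) {M : ℕ} (hM : M ≠ 0) : xlev lam M ^ M = Real.exp lam := by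
  rw [xlev, ← Real.exp_nat_mul]
  congr 1
  field_simp

/-- `x_λ(𝔐)^𝔐 = e^λ` in `ℂ`: the level is a `𝔐`-th root of `κ = e^λ`. -/
theorem xlev_pow_complex (lam : ℝ) {M : ℕ} (hM : M ≠ 0) : ((xlev lam M : ℝ) : ℂ) ^ M = cexp (lam : ℂ) := by
  rw [← Complex.ofReal_pow, xlev_pow lam hM, Complex.ofReal_exp]

/-- The `κ`-power at the collapse: `x_λ^{A'_s} = e^{λ (expo_s).1}`. -/
theorem xlev_pow_Aexp {w : Fin n → ℚ × ℚ} (hu : ∀ l, 0 ≤ (w l).1) (e : Fin n → ℕ) {r : ℚ} (hr : 0 ≤ r)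
    (lam : ℝ) (s : Fin (n + 1) →₀ ℕ) :
    xlev lam (Mden w e r) ^ Aexp w e r s = Real.exp (lam * ((expo w e r s).1 : ℝ)) := by
  rw [xlev, ← Real.exp_nat_mul, expo_fst_real hu e hr]
  congr 1
  ring

/-- **THE EXPONENTIAL AT THE COLLAPSE IS A MONOMIAL IN THE LEVEL AND THE RADIX ROOT**:
`e^{ρ_λ(expo_s)} = x_λ^{A'_s} · c_𝔐^{B'_s}`. -/
theorem exp_ρrL_expo {w : Fin n → ℚ × ℚ} (hu : ∀ l, 0 ≤ (w l).1) (hv : ∀ l, 0 ≤ (w l).2) (e : Fin n → ℕ)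
    {r : ℚ} (hr : 0 ≤ r) (lam : ℝ) (s : Fin (n + 1) →₀ ℕ) :
    Real.exp (ρrL lam (expo w e r s)) =
      xlev lam (Mden w e r) ^ Aexp w e r s * croot (Mden w e r) ^ Bexp w e r s := by
  rw [xlev_pow_Aexp hu e hr, croot_pow_Bexp hv e hr, ← Real.exp_add, ρrL]
  congr 1
  ring

/-- **THE `0`-TH CONJUGATE FACTOR AT THE LEVEL IS THE CLEARED COLLAPSED RELATION**:
`G₀(x_λ) = den(r)^D · F_λ(r)`. -/
theorem eval_Gfac_zeroL (lam : ℝ) (P : MvPolynomial (Fin (n + 1)) ℤ) {D : ℕ}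
    (hD : ∀ s ∈ P.support, s 0 ≤ D) {w : Fin n → ℚ × ℚ} (hu : ∀ l, 0 ≤ (w l).1) (hv : ∀ l, 0 ≤ (w l).2)
    (e : Fin n → ℕ) {r : ℚ} (hr : 0 ≤ r) :
    (Gfac (Mden w e r) P.support (coef P D r) (Aexp w e r) (Bexp w e r) 0).eval
        ((xlev lam (Mden w e r) : ℝ) : ℂ) = (r.den : ℂ) ^ D * FRL lam P w e (r : ℝ) := by
  rw [← sum_coef_expL lam P hD w e r, Gfac, eval_finsetSum]
  refine Finset.sum_congr rfl fun s _ => ?_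
  rw [eval_mul, eval_pow, eval_C, eval_X, broot_zero, ριL, ← Complex.ofReal_exp, exp_ρrL_expo hu hv e hr lam s]
  push_cast
  ring

/-- Size of a conjugate factor on the WHOLE CIRCLE `‖z‖ = x_λ` (all the `𝔐`-th roots `ζ^j x_λ` of `κ` lie on it):
every term is at most `|coef_s| · e^{ρ_λ(expo_s)}`. -/
theorem norm_eval_Gfac_levelL_le (lam : ℝ) (P : MvPolynomial (Fin (n + 1)) ℤ) (D : ℕ)
    {w : Fin n → ℚ × ℚ} (hu : ∀ l, 0 ≤ (w l).1) (hv : ∀ l, 0 ≤ (w l).2) (e : Fin n → ℕ) {r : ℚ} (hr : 0 ≤ r)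
    (i : ℕ) {z : ℂ} (hz : ‖z‖ = xlev lam (Mden w e r)) :
    ‖(Gfac (Mden w e r) P.support (coef P D r) (Aexp w e r) (Bexp w e r) i).eval z‖ ≤
      ∑ s ∈ P.support, |(coef P D r s : ℝ)| * Real.exp (ρrL lam (expo w e r s)) := by
  refine (norm_eval_Gfac_le_of_norm_eq (Mden_pos w e r).ne' _ _ _ _ i hz).trans (le_of_eq ?_)
  refine Finset.sum_congr rfl fun s _ => ?_
  rw [exp_ρrL_expo hu hv e hr lam s]
  ring

end LevelPoint

/-! ## §4  THE LEVEL-TRANSPORT ENGINE: algebraic independence along the `λ`-radix curve from a TRANSCENDENCE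
TYPE of the fixed number `κ = e^λ` -/

section Engine

variable {n : ℕ}

/-- Each exponent of a support monomial is at most the total degree (tree one-liner, private copy). -/
private theorem apply_le_totalDegree' {P : MvPolynomial (Fin (n + 1)) ℤ} {s : Fin (n + 1) →₀ ℕ}
    (hs : s ∈ P.support) (i : Fin (n + 1)) : s i ≤ P.totalDegree := by
  refine le_trans ?_ (MvPolynomial.le_totalDegree hs)
  by_cases hi : i ∈ s.support
  · exact Finset.single_le_sum (f := fun j => s j) (fun _ _ => Nat.zero_le _) hi
  · simp [Finsupp.notMem_support_iff.mp hi]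

/-- **ENDGAME ARITHMETIC OF THE TRANSPORT (the budget lemma).**  The type-`τ` lower bound
`exp(−C_t Φ^τ) ≤ V` with `0 ≤ Φ ≤ c₁ q^a`, against the upper bound `V ≤ M · X_p · η`, `X_p ≤ e^{L q^a}`,
`η < e^{−q^m}`, is contradictory as soon as `m ≥ a·τ + 1` and `q ≥ C_t c₁^τ + M + L + 1`.
(In the engine `a = 2K + 1`, `K = Σ_l e_l`: `deg R̃ ≲ q^{2K}`, `log H(R̃) ≲ 𝔐² q ≲ q^{2K+1}`.) -/
theorem endgame_transport {q m a τ : ℕ} {Ct c₁ M L Φ V Xp η : ℝ} (hq : 1 ≤ q) (hCt : 0 ≤ Ct)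
    (hM : 0 < M) (hL : 0 ≤ L) (hτ : 1 ≤ τ) (hm : a * τ + 1 ≤ m) (hΦ0 : 0 ≤ Φ)
    (hΦ : Φ ≤ c₁ * (q : ℝ) ^ a) (hlow : Real.exp (-(Ct * Φ ^ τ)) ≤ V) (hV : V ≤ M * Xp * η)
    (hXp : Xp ≤ Real.exp (L * (q : ℝ) ^ a)) (hη0 : 0 ≤ η) (hη : η < Real.exp (-((q : ℝ) ^ m)))
    (hC : Ct * c₁ ^ τ + M + L + 1 ≤ q) : False := by
  have hq1 : (1 : ℝ) ≤ q := by exact_mod_cast hq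
  have h1 : V < M * Real.exp (L * (q : ℝ) ^ a) * Real.exp (-((q : ℝ) ^ m)) :=
    calc V ≤ M * Xp * η := hV
      _ ≤ M * Real.exp (L * (q : ℝ) ^ a) * η :=
          mul_le_mul_of_nonneg_right (mul_le_mul_of_nonneg_left hXp hM.le) hη0
      _ < M * Real.exp (L * (q : ℝ) ^ a) * Real.exp (-((q : ℝ) ^ m)) :=
          mul_lt_mul_of_pos_left hη (by positivity)
  have h2 : Real.exp (-(Ct * Φ ^ τ)) < Real.exp (Real.log M + L * (q : ℝ) ^ a + -((q : ℝ) ^ m)) := by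
    rw [Real.exp_add, Real.exp_add, Real.exp_log hM]; exact hlow.trans_lt h1
  rw [Real.exp_lt_exp] at h2
  have hqa1 : (1 : ℝ) ≤ (q : ℝ) ^ a := one_le_pow₀ hq1
  have hqaτ : (q : ℝ) ^ a ≤ (q : ℝ) ^ (a * τ) := pow_le_pow_right₀ hq1 (Nat.le_mul_of_pos_right a hτ)
  have hqm : (q : ℝ) ^ (a * τ + 1) ≤ (q : ℝ) ^ m := pow_le_pow_right₀ hq1 hm
  have hΦτ : Φ ^ τ ≤ c₁ ^ τ * (q : ℝ) ^ (a * τ) :=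
    calc Φ ^ τ ≤ (c₁ * (q : ℝ) ^ a) ^ τ := pow_le_pow_left₀ hΦ0 hΦ τ
      _ = c₁ ^ τ * (q : ℝ) ^ (a * τ) := by rw [mul_pow, ← pow_mul]
  have hlogM : Real.log M ≤ M := (Real.log_le_sub_one_of_pos hM).trans (by linarith)
  have hqat0 : (0 : ℝ) ≤ (q : ℝ) ^ (a * τ) := by positivity
  have e1 : Ct * Φ ^ τ ≤ Ct * c₁ ^ τ * (q : ℝ) ^ (a * τ) := by
    rw [mul_assoc]; exact mul_le_mul_of_nonneg_left hΦτ hCt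
  have e2 : L * (q : ℝ) ^ a ≤ L * (q : ℝ) ^ (a * τ) := mul_le_mul_of_nonneg_left hqaτ hL
  have e3 : M ≤ M * (q : ℝ) ^ (a * τ) := le_mul_of_one_le_right hM.le (hqa1.trans hqaτ)
  have e4 : (Ct * c₁ ^ τ + M + L + 1) * (q : ℝ) ^ (a * τ) ≤ (q : ℝ) * (q : ℝ) ^ (a * τ) :=
    mul_le_mul_of_nonneg_right hC hqat0
  rw [pow_succ'] at hqm
  linarith

end Engine

end Summit.Schanuel.Schanuel.Theorems.RootDecomp1ELevelTransport

end
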